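import Literature.Computability.AlgebraicComplexity.AndrewsForbes2022Thm38Proofs
import Literature.Computability.AlgebraicComplexity.IL17LayeredDetProgram

/-!
# Andrews–Forbes 2022, Corollary 3.9 — discharged

`AndrewsForbes2022_cor_3_9_holds : AndrewsForbes2022_cor_3_9` (char `0`): for nonzero
`f ∈ I^det_{n,m,r}`, `h = f + O(ε)` and `2 t³ ≤ r`, a depth-three `h`-oracle circuit computes
`det_t + O(ε)`.  The printed proof (p0024:L60–L75) is Theorem 3.8 plus "a layered algebraic branching
program for `det_t` on `O(t³)` vertices [MV97, Thm. 2]".  Both ingredients are theorems of the tree: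
`AndrewsForbes2022_thm_3_8_holds` (`AndrewsForbes2022Thm38Proofs.lean`) and IL17's pruned
Mahajan–Vinay program (`IL17LayeredDetProgram.lean`: internal vertices `IL17.Vtx n`, adjacency
`IL17.prN`, source/sink weights `IL17.prSrc`/`IL17.prSnk`, value `IL17.abpValue_prN_eq_detPoly`,
`(m³ − m)/3` internal vertices by `IL17.card_vtx`).  This file only PACKAGES that program as a
`LayeredABPComputes` witness (namespace `Corollary39`): one graph on `Vtx n ⊕ {source, sink}` with the
adjacency matrix `adj` (`−prN` inside — the sign of `(1 + N)⁻¹ = Σ (−N)^j` — `prSrc` out of the source,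
`prSnk` into the sink), layered (`adj_isLayered`), affine labels (`adj_totalDegree_le`), whose
`(n+2)`-step source-to-sink entry is the single surviving term `(prSrc ᵥ* (−prN)^n) ⬝ᵥ prSnk = det_{n+2}`
of IL17's value (`vecMul_pow_dotProduct_eq_detPoly`, by the layering); hence
`LayeredABPComputes (|Vtx n| + 2) det_{n+2}` and `LayeredABPComputes (2 m³) det_m` for `m ≥ 1`
(`det_1 = X₀₀` directly).  The constant of Cor. 3.9 is taken to be `c = 2`; `t = 0` (`det_0 = 1`) is
the trivial circuit `0 · h + 1`.  No new named facts (net debt −1).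

Honest framing: discharge of a typed literature statement (a depth-three oracle REDUCTION from the
determinant to any nonzero member of a determinantal ideal, in the border sense); VP ≠ VNP is NOT
proved.

## References
* [AndrewsForbes2022] R. Andrews, M. A. Forbes, STOC 2022, arXiv:2112.00792 — Cor. 3.9 (p0024).
* [IkenmeyerLandsberg2017] C. Ikenmeyer, J. M. Landsberg, J. Pure Appl. Algebra 221 (2017),
  arXiv:1610.00159 — Prop. 3.2 (the pruned program), as formalised in `IL17LayeredDetProgram.lean`.
* [MahajanVinay1997] M. Mahajan, V. Vinay, Chicago J. Theoret. Comput. Sci. 1997, Art. 5, §3 — the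
  layered determinant program cited as [MV97, Thm. 2] in the printed proof.
-/

noncomputable section

open MvPolynomial

namespace Literature.Computability.AlgebraicComplexity

namespace Corollary39

open IL17 GKKP2011 Berkowitz _root_.Matrix

variable (k : Type) [Field k]

/-! #### Degrees of the Mahajan–Vinay edge labels -/

/-- Packaging of IL17's pruned Mahajan–Vinay program as a layered ABP (`totalDegree_xvar_le`). [cite: IkenmeyerLandsberg2017, Prop. 3.2 (proof)] -/
theorem totalDegree_xvar_le (N a b : ℕ) : (xvar k N a b).totalDegree ≤ 1 := by
  unfold xvar
  split_ifs
  · exact (totalDegree_X (R := k) _).le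
  · rw [totalDegree_zero]; exact Nat.zero_le _

/-- Packaging of IL17's pruned Mahajan–Vinay program as a layered ABP (`totalDegree_stepW_le`). [cite: IkenmeyerLandsberg2017, Prop. 3.2 (proof)] -/
theorem totalDegree_stepW_le (N f t u : ℕ) : (stepW k N f t u).totalDegree ≤ 1 := by
  unfold stepW
  split_ifs
  · exact totalDegree_xvar_le k N _ _
  · rw [totalDegree_neg]; exact totalDegree_xvar_le k N _ _
  · rw [totalDegree_zero]; exact Nat.zero_le _

/-- Packaging of IL17's pruned Mahajan–Vinay program as a layered ABP (`totalDegree_T₀_le`). [cite: IkenmeyerLandsberg2017, Prop. 3.2 (proof)] -/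
theorem totalDegree_T₀_le (N : ℕ) (σ σ' : Fin N × Fin N) : (T₀ k N σ σ').totalDegree ≤ 1 := by
  simp only [T₀, Matrix.of_apply]
  split_ifs <;> first | exact totalDegree_stepW_le k N _ _ _ | (rw [totalDegree_zero]; exact Nat.zero_le _)

variable (n : ℕ)

/-! #### The pruned program with source and sink as one layered graph -/

/-- Vertices: IL17's internal vertices, a source (`inr 0`) and a sink (`inr 1`). [cite: IkenmeyerLandsberg2017, Prop. 3.2 (proof)] -/
abbrev Vert : Type := IL17.Vtx n ⊕ Fin 2

/-- Layers: source `0`, internal vertex `(i, t, u)` at `i + 1`, sink `n + 2`. [cite: IkenmeyerLandsberg2017, Prop. 3.2 (proof)] -/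
def layer : Vert n → ℕ := Sum.elim (fun v => (v.1.1 : ℕ) + 1) (fun i => if i = 0 then 0 else n + 2)

/-- Adjacency matrix: `−prN` inside (the sign of `(1 + N)⁻¹ = Σ (−N)^j`), `prSrc` out of the
source, `prSnk` into the sink. [cite: IkenmeyerLandsberg2017, Prop. 3.2 (proof)] -/
def adj : Matrix (Vert n) (Vert n) (MvPolynomial (Fin (n + 2) × Fin (n + 2)) k) :=
  Matrix.of fun u v =>
    match u, v with
    | Sum.inl u, Sum.inl v => -prN k n u v
    | Sum.inr i, Sum.inl v => if i = 0 then prSrc k n v else 0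
    | Sum.inl u, Sum.inr j => if j = 1 then prSnk k n u else 0
    | Sum.inr _, Sum.inr _ => 0

variable {k n}

/-- Packaging of IL17's pruned Mahajan–Vinay program as a layered ABP (`adj_inl_inl`). [cite: IkenmeyerLandsberg2017, Prop. 3.2 (proof)] -/
theorem adj_inl_inl (u v : IL17.Vtx n) : adj k n (Sum.inl u) (Sum.inl v) = -prN k n u v := rfl
/-- Packaging of IL17's pruned Mahajan–Vinay program as a layered ABP (`adj_src_inl`). [cite: IkenmeyerLandsberg2017, Prop. 3.2 (proof)] -/
theorem adj_src_inl (v : IL17.Vtx n) : adj k n (Sum.inr 0) (Sum.inl v) = prSrc k n v := rfl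
/-- Packaging of IL17's pruned Mahajan–Vinay program as a layered ABP (`adj_snk_inl`). [cite: IkenmeyerLandsberg2017, Prop. 3.2 (proof)] -/
theorem adj_snk_inl (v : IL17.Vtx n) : adj k n (Sum.inr 1) (Sum.inl v) = 0 := rfl
/-- Packaging of IL17's pruned Mahajan–Vinay program as a layered ABP (`adj_inl_snk`). [cite: IkenmeyerLandsberg2017, Prop. 3.2 (proof)] -/
theorem adj_inl_snk (u : IL17.Vtx n) : adj k n (Sum.inl u) (Sum.inr 1) = prSnk k n u := rfl
/-- Packaging of IL17's pruned Mahajan–Vinay program as a layered ABP (`adj_inl_src`). [cite: IkenmeyerLandsberg2017, Prop. 3.2 (proof)] -/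
theorem adj_inl_src (u : IL17.Vtx n) : adj k n (Sum.inl u) (Sum.inr 0) = 0 := rfl
/-- Packaging of IL17's pruned Mahajan–Vinay program as a layered ABP (`adj_inr_inr`). [cite: IkenmeyerLandsberg2017, Prop. 3.2 (proof)] -/
theorem adj_inr_inr (i j : Fin 2) : adj k n (Sum.inr i) (Sum.inr j) = 0 := rfl

/-- Packaging of IL17's pruned Mahajan–Vinay program as a layered ABP (`adj_to_src`). [cite: IkenmeyerLandsberg2017, Prop. 3.2 (proof)] -/
theorem adj_to_src (x : Vert n) : adj k n x (Sum.inr 0) = 0 := by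
  rcases x with u | i
  · rfl
  · rfl

/-- Packaging of IL17's pruned Mahajan–Vinay program as a layered ABP (`prSrc_ne_zero`). [cite: IkenmeyerLandsberg2017, Prop. 3.2 (proof)] -/
theorem prSrc_ne_zero {v : IL17.Vtx n} (h : prSrc k n v ≠ 0) : (v.1.1 : ℕ) = 0 := by
  by_contra hne
  exact h (by simp [prSrc, fullSrc, hne])

/-- Packaging of IL17's pruned Mahajan–Vinay program as a layered ABP (`prSnk_ne_zero`). [cite: IkenmeyerLandsberg2017, Prop. 3.2 (proof)] -/
theorem prSnk_ne_zero {v : IL17.Vtx n} (h : prSnk k n v ≠ 0) : (v.1.1 : ℕ) = n := by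
  by_contra hne
  exact h (by simp [prSnk, fullSnk, hne])

/-- Packaging of IL17's pruned Mahajan–Vinay program as a layered ABP (`adj_isLayered`). [cite: IkenmeyerLandsberg2017, Prop. 3.2 (proof)] -/
theorem adj_isLayered : ∀ u v, adj k n u v ≠ 0 → layer n v = layer n u + 1 := by
  rintro (u | i) (v | j) h
  · have := prN_isLayered (k := k) (n := n) u v (by rwa [adj_inl_inl, neg_ne_zero] at h)
    simp only [layer, Sum.elim_inl] at this ⊢
    omega
  · fin_cases j
    · exact absurd rfl h
    · have := prSnk_ne_zero (k := k) (by simpa [adj] using h)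
      simp [layer, this]
  · fin_cases i
    · have := prSrc_ne_zero (k := k) (by simpa [adj] using h)
      simp [layer, this]
    · exact absurd rfl h
  · exact absurd rfl h

/-- Packaging of IL17's pruned Mahajan–Vinay program as a layered ABP (`adj_totalDegree_le`). [cite: IkenmeyerLandsberg2017, Prop. 3.2 (proof)] -/
theorem adj_totalDegree_le : ∀ u v, (adj k n u v).totalDegree ≤ 1 := by
  rintro (u | i) (v | j)
  · rw [adj_inl_inl, totalDegree_neg]
    simp only [prN, fullN, Matrix.of_apply]
    split_ifs
    · exact totalDegree_T₀_le k _ _ _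
    · rw [totalDegree_zero]; exact Nat.zero_le _
  · fin_cases j
    · show (0 : MvPolynomial _ k).totalDegree ≤ 1
      rw [totalDegree_zero]; exact Nat.zero_le _
    · show (prSnk k n u).totalDegree ≤ 1
      simp only [prSnk, fullSnk]
      split_ifs
      · exact totalDegree_T₀_le k _ _ _
      · rw [totalDegree_zero]; exact Nat.zero_le _
  · fin_cases i
    · show (prSrc k n v).totalDegree ≤ 1
      simp only [prSrc, fullSrc, start₀]
      split_ifs
      · exact totalDegree_stepW_le k _ _ _ _
      · rw [totalDegree_zero]; exact Nat.zero_le _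
    · show (0 : MvPolynomial _ k).totalDegree ≤ 1
      rw [totalDegree_zero]; exact Nat.zero_le _
  · show (0 : MvPolynomial _ k).totalDegree ≤ 1
    rw [totalDegree_zero]; exact Nat.zero_le _

/-- Paths from the source: after `j + 1` edges one is at an internal vertex with the weight
`(prSrc ᵥ* (−prN)^j) v`. [cite: IkenmeyerLandsberg2017, Prop. 3.2 (proof)] -/
theorem adj_pow_src_inl : ∀ (j : ℕ) (v : IL17.Vtx n),
    (adj k n ^ (j + 1)) (Sum.inr 0) (Sum.inl v) = (prSrc k n ᵥ* (-prN k n) ^ j) v := by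
  intro j
  induction j with
  | zero => intro v; simp [adj_src_inl]
  | succ j ih =>
    intro v
    have h0 : (adj k n ^ (j + 1)) (Sum.inr 0) (Sum.inr 0) = 0 := by
      rw [pow_succ, Matrix.mul_apply]
      exact Finset.sum_eq_zero fun x _ => by rw [adj_to_src, mul_zero]
    rw [show adj k n ^ (j + 1 + 1) = adj k n ^ (j + 1) * adj k n from pow_succ _ _, Matrix.mul_apply,
      Fintype.sum_sum_type, Fin.sum_univ_two, adj_src_inl, adj_snk_inl, mul_zero, add_zero, h0,
      zero_mul, add_zero, show (-prN k n) ^ (j + 1) = (-prN k n) ^ j * (-prN k n) from pow_succ _ _,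
      ← Matrix.vecMul_vecMul, Matrix.vecMul, dotProduct]
    refine Finset.sum_congr rfl fun u _ => ?_
    rw [ih u, adj_inl_inl, Matrix.neg_apply]

/-- Packaging of IL17's pruned Mahajan–Vinay program as a layered ABP (`adj_pow_src_snk`). [cite: IkenmeyerLandsberg2017, Prop. 3.2 (proof)] -/
theorem adj_pow_src_snk :
    (adj k n ^ (n + 2)) (Sum.inr 0) (Sum.inr 1) = (prSrc k n ᵥ* (-prN k n) ^ n) ⬝ᵥ prSnk k n := by
  rw [pow_succ, Matrix.mul_apply, Fintype.sum_sum_type, Fin.sum_univ_two, adj_inr_inr, adj_inr_inr,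
    mul_zero, mul_zero, add_zero, add_zero, dotProduct]
  refine Finset.sum_congr rfl fun v _ => ?_
  rw [adj_pow_src_inl, adj_inl_snk]

/-- The value of the pruned program as a single layered term: `det_{n+2}`. [cite: IkenmeyerLandsberg2017, Prop. 3.2 (proof)] -/
theorem vecMul_pow_dotProduct_eq_detPoly :
    (prSrc k n ᵥ* (-prN k n) ^ n) ⬝ᵥ prSnk k n = detPoly (Fin (n + 2)) k := by
  classical
  have hval := abpValue_prN_eq_detPoly (k := k) (n := n)
  unfold abpValue geomInv at hval
  rw [Matrix.dotProduct_mulVec, Matrix.vecMul_sum, sum_dotProduct] at hval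
  rw [← hval, Finset.sum_eq_single_of_mem n (by simp)]
  intro j hj hjn
  -- a path with `j ≠ n` internal edges cannot reach the sink
  rw [dotProduct]
  refine Finset.sum_eq_zero fun v _ => ?_
  by_cases hv : prSnk k n v = 0
  · rw [hv, mul_zero]
  rw [Matrix.vecMul, dotProduct]
  rw [Finset.sum_eq_zero, zero_mul]
  intro u _
  by_cases hu : prSrc k n u = 0
  · rw [hu, zero_mul]
  by_cases huv : ((-prN k n) ^ j) u v = 0
  · rw [huv, mul_zero]
  exfalso
  have hlay : IsLayered (-prN k n) (fun v : IL17.Vtx n => (v.1.1 : ℕ)) := fun a b hab =>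
    prN_isLayered (k := k) a b (by rwa [Matrix.neg_apply, neg_ne_zero] at hab)
  have h1 := hlay.pow_apply_ne_zero j u v huv
  have h2 := prSrc_ne_zero (k := k) hu
  have h3 := prSnk_ne_zero (k := k) hv
  omega

/-- `det_{n+2}` is computed by a layered ABP on `|IL17.Vtx n| + 2 = ((n+2)³ − (n+2))/3 + 2` vertices
(IL17's pruned Mahajan–Vinay program with source and sink). [cite: IkenmeyerLandsberg2017, Prop. 3.2 (proof)] -/
theorem layeredABPComputes_detPoly_add_two :
    LayeredABPComputes (Fintype.card (IL17.Vtx n) + 2) (detPoly (Fin (n + 2)) k) := by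
  classical
  have h := layeredABPComputes_of_fintype (R := k) (ι := Fin (n + 2) × Fin (n + 2)) (V := Vert n)
    (m := Fintype.card (IL17.Vtx n) + 2) (by simp [Fintype.card_sum]) (layer n) (Sum.inr 0) (Sum.inr 1)
    (adj k n) adj_isLayered adj_totalDegree_le
  have hl : layer n (Sum.inr 1) - layer n (Sum.inr 0) = n + 2 := by simp [layer]
  rwa [hl, adj_pow_src_snk, vecMul_pow_dotProduct_eq_detPoly] at h

/-- Packaging of IL17's pruned Mahajan–Vinay program as a layered ABP (`layeredABPComputes_detPoly_cubic`). [cite: IkenmeyerLandsberg2017, Prop. 3.2 (proof)] -/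
theorem layeredABPComputes_detPoly_cubic (m : ℕ) (hm : 1 ≤ m) :
    LayeredABPComputes (2 * m ^ 3) (detPoly (Fin m) k) := by
  classical
  rcases m with _ | m
  · omega
  rcases m with _ | n
  · -- `det_1 = X₀₀`
    have : detPoly (Fin 1) k = X ((0 : Fin 1), (0 : Fin 1)) := by
      rw [detPoly, Matrix.det_unique]; rfl
    rw [this]
    exact layeredABPComputes_X _ (by norm_num)
  · refine (layeredABPComputes_detPoly_add_two (k := k) (n := n)).mono ?_
    rw [card_vtx]
    have hx : (n + 1 + 1) ^ 3 = (n + 2) ^ 3 := rfl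
    rw [hx]
    have h8 : 8 ≤ (n + 2) ^ 3 := by
      calc 8 = 2 ^ 3 := by norm_num
        _ ≤ (n + 2) ^ 3 := Nat.pow_le_pow_left (by omega) 3
    omega

end Corollary39

/-- **Discharge of `AndrewsForbes2022_cor_3_9`** (Corollary 3.9, char 0), following the printed proof
(p0024:L60–L75): Theorem 3.8 (`AndrewsForbes2022_thm_3_8_holds`) applied to a layered ABP for
`det_t` with `≤ 2t³` vertices — here IL17's pruned Mahajan–Vinay program
(`IL17LayeredDetProgram.lean`, `(t³ − t)/3 + 2` vertices; [MV97, Thm. 2] in print) packaged as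
`Corollary39.layeredABPComputes_detPoly_cubic`; `t = 0` (`det_0 = 1`) is the trivial circuit.
[cite: AndrewsForbes2022, Cor. 3.9] -/
theorem AndrewsForbes2022_cor_3_9_holds : AndrewsForbes2022_cor_3_9 := by
  refine ⟨2, fun F _ _ n m r f hf hf0 h hh t ht => ?_⟩
  rcases Nat.eq_zero_or_pos t with rfl | htpos
  · -- `det_0 = 1`: the circuit `0 · h + 1`
    have h1 : detPoly (Fin 0) F = 1 := by simp [detPoly]
    refine ⟨0, fun _ => 0, 0, 1, fun _ => by rw [totalDegree_zero]; exact Nat.zero_le _, ?_⟩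
    simp only [h1, map_one, map_zero, zero_mul, zero_add, sub_self]
    exact PolyOrdGE.zero 1
  · exact AndrewsForbes2022_thm_3_8_holds F n m r f hf hf0 h hh _ _
      (InLayeredABPBorder.of_computes
        ((Corollary39.layeredABPComputes_detPoly_cubic (k := F) t htpos).mono ht))

end Literature.Computability.AlgebraicComplexity
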